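import Summits.QuantumFields.YangMills.Theorems.UnitScaleTiltProp7NestedMeanTowerInduction
import Summits.QuantumFields.YangMills.Theorems.UnitScaleTiltProp8IterPlaqSmallAllL
import Summits.QuantumFields.YangMills.Theorems.UnitScaleTiltProp7AxialGaugeBlock
import Summits.QuantumFields.YangMills.Theorems.UnitScaleTiltProp8ChartHInvGeometry
import Summits.QuantumFields.YangMills.Theorems.UnitScaleTiltProp8ChartCovariance
import Summits.QuantumFields.YangMills.Theorems.UnitScaleTiltProp7QTwSCentralTowerRows
import HarnessLib

/-!
# Route `UnitScaleTilt`, crux K1 child «MinimiserStabilityRegPr» (stmt-QuantumFields-19200), skeleton v10, stub `stub_existenceMinimalOrbit` (EX), route (α) —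
# **R2a′-TOWER (ROW-T), PART 1∕2: THE PER-LEVEL TOWER CLOSENESS `η_j` OF ✓`Prop7NestedMeanPoincare.norm_ns_sub_refMean_le` BY CORNER-BASED BLOCK-AXIAL GAUGES.**
# For the averaging sequence of ✓`Prop7SymAvgTwSGaugeDir.QTwS_gaugeDir_of_avgSeq` the transports are the stair holonomies of the background tower,
# `T_{j,y,i} = Ū₀⁽ʲ⁾(Γ^σ_{y,i})` (`holT (emlIterU j U) (emb y) (stairWord i.2.1 (off i.1))`).  Choose the reference unitaries
# **`C_{j,z,x} := (w_x(embIter j z))⁻¹ · w_x(x)`**, `w_x := axialT U (q (iterBlockOf k x))` — the comb holonomies of `U` from a base point `q(Y)` of the TOP block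
# `Y = B^k(x)` of the fine site `x` (part 2 takes `q(Y)` = the block corner, hcomb's base point).  Then `C_{0,x,x} = 1` is the group law, and by the
# covariance of the tower ([Balaban1985Averaging] (11): `Ū⁽ʲ⁾(U^{w}) = (Ū⁽ʲ⁾U)^{w∘embIter j}`, ✓`Prop8Chart.emlIterU_gaugeActT`) the closeness defect is a
# holonomy of the GAUGE-TRANSFORMED tower minus one: `‖T·C_{j,z,x} − C_{j+1,y,x}‖ ≤ ‖Ū⁽ʲ⁾[U^{w_x}](Γ^σ_{y,i}) − 1‖`, which telescopes along the staircase
# (inside `B(y) ⊂ B^k(Y)`, ✓`ChartHInv.blockOf_of_mem_walk_stairWord`) into the k-uniform bond bound of [Balaban1985Averaging] Prop. 4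
# (✓`Prop8Chart.norm_emlIterU_sub_one_le_of_reads`: `‖Ū⁽ʲ⁾(e) − 1‖ ≤ 30ℓ·Lʲ·s₀` when the fine bonds read are `s₀`-close to `1`) — the fine bonds of `B^k(Y)`
# in the block-axial gauge being `s₀`-close to `1` by [Balaban1985RegularSpaces] Lemma 1 (✓`Prop7AxialGaugeSup.dist1_mul_inv_le_of_axial`; here at the
# CORNER base, `dist1_axial_corner_le`).  NO lattice Stokes beyond those letters, no dilation, no `U′`.

Cell `ym3-torus`, width seat `ym3-torus-px11` (gen 2); ★w5-20520 g7's (P2-core) plan v2, «px11: R2a′-TOWER GO» 19:27:10Z; socket = ★px20 g2's ROW-B (B3) rows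
`hclose`∕`hC`.  THEOREMS ONLY (0 `def`, 0 `sorry`).  `--supports stmt-QuantumFields-19200 --as helper`, count-neutral.  YM₃ on T³ is a ladder rung (R3), not the
Clay problem; nothing here claims the stub, the crux, d = 4 or the mass gap.

WHAT IS PROVED (sorry-free, no definition; generic `P`).
* §1 letters: `norm_holT_sub_one_le_of_walk` (`U1` telescoping along the bonds OF THE WALK), `iterBlockOf_add_eq_of_eq` ∕ `iterBlockOf_eq_of_le` (nesting of the
  block maps), `rel_corner_apply` ∕ `noWrap_corner` ∕ `l1_rel_corner_le` ∕ `rel_corner_fibreSite` (the relative position from the block CORNER is the label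
  remainder — no wrap-around), ★`dist1_axial_corner_le` (every fine bond of `B^k(Y)` is `2d(L^k − 1)·a₀`-close to `1` in the corner-based axial gauge).
* §2 ★★`norm_stair_mul_ref_sub_ref_le` — the row `hclose` of ✓p657637 for `j + 1 ≤ k` at the gauge-indexed references, for ANY base-point map `q`, under the
  abstract bond row `hax` («fine bonds of `B^k(Y)` are `s₀`-close to `1` in the gauge `axialT U (q Y)`») and the budget `6400ℓ²Lʲs₀ ≤ 1`:
  `‖T·C_{j,z,x} − C_{j+1,y,x}‖ ≤ ℓ·(30ℓ·Lʲ·s₀)`, `ℓ = (d+2)L`; `ref_zero_self` (`hC0`), `ref_mem_U1` (`hC`-unitarity), `holT_tower_conj_eq` (the covariance identity).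
* §3 ★`ref_top_fibreSite_eq` — at the top level and the CORNER base the reference at `x_r = fibreSite 0 k y r` IS `g_y · U(Γ_{corner,r})` with
  `g_y = (axialT U corner (embIter k y))⁻¹`: ★px20 g2's row `hC` as an IDENTITY (`η' = 0`).
HONEST SCOPE.  Part 2 (`…NestedMeanTowerClosenessT3`) discharges `hax` and the budgets at the d = 3 carrier from `PlaqSmall (regThreshold F n K ε₀) U₀`; the
`hsucc → mean-form` bridge and the socket are ★px20 g2's ROW-B; nothing of print is asserted beyond the cited bookkeeping.

References: T. Bałaban, CMP **98** (1985) 17–51 [Balaban1985Averaging] ((8)–(11) pp.18–19, pp.24–25, Prop. 4 (134)–(135) p.38, (97) p.32);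
CMP **99** (1985) 75–102 [Balaban1985RegularSpaces] (Lemma 1 (1.25) p.79); CMP **95** (1984) 17–40 [Balaban1984PropagatorsI] ((1.6)–(1.7) p.18, (1.16)–(1.18) p.20);
CMP **109** (1987) 249–301 [Balaban1987RG1] ((0.1)–(0.4), (0.11) pp.251–253).
-/

set_option autoImplicit false

noncomputable section

open scoped BigOperators Matrix.Norms.L2Operator

namespace Summit.QuantumFields.YangMills.Theorems.Prop7NestedMeanTowerCloseness

open Literature.MathematicalPhysics.QuantumFieldTheory.Balaban1983to89
open T4Continuum BlockAveraging BlockAveragingEMLLinearised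
open B5Eq118OneStroke (iterBlockOf iterBlock mem_iterBlock iterBlockOf_zero iterBlockOf_succ val_iterBlockOf)
open B15DeterminingSets (embIter)
open B7Prop1Explicit (U1 mem_U1 norm_inv_sub_one_le treeWord l1)
open B10Eq27TorusAxialLog (holT holT_nil holT_cons_true holT_cons_false rel rel_apply axialT axialT_self gaugeActT gaugeActT_apply unitsField toUField)
open Summit.QuantumFields.YangMills.Theorems.Prop8Chart (emlIterU holT_gaugeActT emlIterU_gaugeActT norm_emlIterU_sub_one_le_of_reads coe_unitsField_toUField)
open Summit.QuantumFields.YangMills.Theorems.ChartHInv (blockOf_of_mem_walk_stairWord)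
open Summit.QuantumFields.YangMills.Theorems.Prop7FlatHolonomy (sitesPerDir_zero_eq_mul_pow)
open Summit.QuantumFields.YangMills.Theorems.Prop7CombGauge (iterBlockOf_fibreSite)
open Summit.QuantumFields.YangMills.Theorems.Prop7AxialGaugeSup (dist1_mul_inv_le_of_axial)
open Summit.QuantumFields.YangMills.Theorems.IterPlaqSmallAllL (axialT_gaugeActT_axialT plaqSmall_gaugeActT)
open Summit.QuantumFields.YangMills.Theorems.Prop7SymAvgTwSym (holT_mem_U1)

variable {P : Params}

/-! ## §1 Letters -/

section Telescoping

variable {𝔸 : Type*} [NormedRing 𝔸] [NormOneClass 𝔸] {j : ℕ}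

/-- **`U1` TELESCOPING ALONG THE BONDS OF THE WALK**: for a `U1`-valued configuration `W` on `T^{(j)}` and a word `w` from `x` whose walk only traverses bonds with
`‖W(b) − 1‖ ≤ s`, `‖W(w-walk) − 1‖ ≤ |w|·s` (`‖ab − 1‖ ≤ ‖a − 1‖ + ‖b − 1‖` for `‖b‖ ≤ 1`; `‖W(b)⁻¹ − 1‖ ≤ ‖W(b) − 1‖` on `U1`).
[cite: Balaban1985Averaging, (9) p.18 and (19)-(20) p.21] -/
theorem norm_holT_sub_one_le_of_walk (W : GaugeField P j 𝔸ˣ) (hW : ∀ b, W b ∈ U1 𝔸) {s : ℝ} (hs : 0 ≤ s) :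
    ∀ (w : List (Letter P.d)) (x : Site P j), (∀ st ∈ walk x w, ‖((W st.bond : 𝔸ˣ) : 𝔸) - 1‖ ≤ s) →
      ‖((holT W x w : 𝔸ˣ) : 𝔸) - 1‖ ≤ w.length * s
  | [], x, _ => by simp [holT_nil]
  | (μ, true) :: w, x, h => by
    have hmul : ∀ (a b : 𝔸), ‖b‖ ≤ 1 → ‖a * b - 1‖ ≤ ‖a - 1‖ + ‖b - 1‖ := by
      intro a b hb
      have e : a * b - 1 = (a - 1) * b + (b - 1) := by noncomm_ring
      rw [e]
      calc ‖(a - 1) * b + (b - 1)‖ ≤ ‖a - 1‖ * ‖b‖ + ‖b - 1‖ := (norm_add_le _ _).trans (add_le_add (norm_mul_le _ _) le_rfl)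
        _ ≤ ‖a - 1‖ * 1 + ‖b - 1‖ := by gcongr
        _ = ‖a - 1‖ + ‖b - 1‖ := by ring
    have hhead : ‖((W ⟨x, μ⟩ : 𝔸ˣ) : 𝔸) - 1‖ ≤ s := h ⟨⟨x, μ⟩, true⟩ (by simp [walk])
    have htail := norm_holT_sub_one_le_of_walk W hW hs w (x.shift μ) (fun st hst => h st (by simp [walk, hst]))
    rw [holT_cons_true, Units.val_mul, List.length_cons, Nat.cast_succ, add_mul, one_mul, add_comm ((w.length : ℝ) * s)]
    exact (hmul _ _ (mem_U1.1 (holT_mem_U1 hW _ _)).1).trans (add_le_add hhead htail)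
  | (μ, false) :: w, x, h => by
    have hmul : ∀ (a b : 𝔸), ‖b‖ ≤ 1 → ‖a * b - 1‖ ≤ ‖a - 1‖ + ‖b - 1‖ := by
      intro a b hb
      have e : a * b - 1 = (a - 1) * b + (b - 1) := by noncomm_ring
      rw [e]
      calc ‖(a - 1) * b + (b - 1)‖ ≤ ‖a - 1‖ * ‖b‖ + ‖b - 1‖ := (norm_add_le _ _).trans (add_le_add (norm_mul_le _ _) le_rfl)
        _ ≤ ‖a - 1‖ * 1 + ‖b - 1‖ := by gcongr
        _ = ‖a - 1‖ + ‖b - 1‖ := by ring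
    have hhead : ‖(((W ⟨x.unshift μ, μ⟩)⁻¹ : 𝔸ˣ) : 𝔸) - 1‖ ≤ s :=
      (norm_inv_sub_one_le (hW _)).trans (h ⟨⟨x.unshift μ, μ⟩, false⟩ (by simp [walk]))
    have htail := norm_holT_sub_one_le_of_walk W hW hs w (x.unshift μ) (fun st hst => h st (by simp [walk, hst]))
    rw [holT_cons_false, Units.val_mul, List.length_cons, Nat.cast_succ, add_mul, one_mul, add_comm ((w.length : ℝ) * s)]
    exact (hmul _ _ (mem_U1.1 (holT_mem_U1 hW _ _)).1).trans (add_le_add hhead htail)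

end Telescoping

section Blocks

/-- Nesting of the block maps: `B^{j+t}` is constant on `B^j`-classes. [cite: Balaban1984PropagatorsI, (1.16)-(1.18) p.20] -/
theorem iterBlockOf_add_eq_of_eq {j : ℕ} {x x' : Site P 0} (h : iterBlockOf j x' = iterBlockOf j x) :
    ∀ t : ℕ, iterBlockOf (j + t) x' = iterBlockOf (j + t) x
  | 0 => h
  | t + 1 => by
    show blockOf (iterBlockOf (j + t) x') = blockOf (iterBlockOf (j + t) x)
    rw [iterBlockOf_add_eq_of_eq h t]

/-- `B^j(x′) = B^j(x) ⟹ B^k(x′) = B^k(x)` for `j ≤ k`. [cite: Balaban1984PropagatorsI, (1.16)-(1.18) p.20] -/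
theorem iterBlockOf_eq_of_le {j k : ℕ} (hjk : j ≤ k) {x x' : Site P 0} (h : iterBlockOf j x' = iterBlockOf j x) :
    iterBlockOf k x' = iterBlockOf k x := by
  obtain ⟨t, rfl⟩ := Nat.exists_eq_add_of_le hjk
  exact iterBlockOf_add_eq_of_eq h t

variable {k : ℕ}

/-- **THE RELATIVE POSITION FROM THE BLOCK CORNER IS THE LABEL REMAINDER** (no wrap-around; the torus has at least two `k`-blocks per direction): for `x ∈ B^k(Y)`,
`rel (corner Y) x ν = x_ν mod L^k`, `corner Y = fibreSite 0 k Y 0` (label `Y·L^k`). [cite: Balaban1984PropagatorsI, (1.6)-(1.7) p.18; Balaban1987RG1, (0.1) p.252] -/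
theorem rel_corner_apply (hk : k ≤ P.m + P.K) {Y : Site P k} {x : Site P 0} (hx : iterBlockOf k x = Y) (h0 : 0 < P.L ^ k) (ν : Fin P.d) :
    rel (Site.fibreSite 0 k Y fun _ => (⟨0, h0⟩ : Fin (P.L ^ k))) x ν = (((x ν).val % P.L ^ k : ℕ) : ℤ) := by
  set N := P.sitesPerDir 0 with hN
  have hN2 : 2 * P.L ^ k ≤ N := by
    rw [hN, sitesPerDir_zero_eq_mul_pow hk]
    exact Nat.mul_le_mul_right _ (P.one_lt_sitesPerDir k)
  have hYv : (Y ν).val = (x ν).val / P.L ^ k := by rw [← hx, val_iterBlockOf k hk x ν]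
  generalize hr : (x ν).val % P.L ^ k = r
  have hdm : (x ν).val = (Y ν).val * P.L ^ k + r := by rw [hYv, ← hr, mul_comm]; exact (Nat.div_add_mod _ _).symm
  have hmod : r < P.L ^ k := by rw [← hr]; exact Nat.mod_lt _ h0
  rw [rel_apply]
  apply (ZMod.valMinAbs_spec _ _).mpr
  constructor
  · have hxv : (x ν : ZMod N) = ((((x ν).val : ℕ) : ℤ) : ZMod N) := by rw [Int.cast_natCast, ZMod.natCast_zmod_val]
    have hq : (Site.fibreSite 0 k Y (fun _ => (⟨0, h0⟩ : Fin (P.L ^ k))) ν : ZMod N) = ((((Y ν).val * P.L ^ k + 0 : ℕ) : ℤ) : ZMod N) := by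
      rw [Int.cast_natCast]; rfl
    rw [hxv, hq, ← Int.cast_sub]
    congr 1
    rw [hdm]; push_cast; ring
  · have hr' : (r : ℤ) + 1 ≤ ((P.L ^ k : ℕ) : ℤ) := by exact_mod_cast hmod
    have h2 : ((P.L ^ k : ℕ) : ℤ) * 2 ≤ (N : ℤ) := by exact_mod_cast (show P.L ^ k * 2 ≤ N by omega)
    have hr0 : (0 : ℤ) ≤ r := by positivity
    constructor <;> linarith

/-- **NO WRAP-AROUND AT THE CORNER**: `2·((x − corner)_μ + 1) ≤ N₀` on `B^k(Y)`. [cite: Balaban1987RG1, (0.1) p.252] -/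
theorem noWrap_corner (hk : k ≤ P.m + P.K) {Y : Site P k} {x : Site P 0} (hx : iterBlockOf k x = Y) (h0 : 0 < P.L ^ k) (μ : Fin P.d) :
    (rel (Site.fibreSite 0 k Y fun _ => (⟨0, h0⟩ : Fin (P.L ^ k))) x μ + 1) * 2 ≤ (P.sitesPerDir 0 : ℤ) := by
  rw [rel_corner_apply hk hx h0 μ]
  have hmod : (x μ).val % P.L ^ k < P.L ^ k := Nat.mod_lt _ h0
  have hN2 : 2 * P.L ^ k ≤ P.sitesPerDir 0 := by
    rw [sitesPerDir_zero_eq_mul_pow hk]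
    exact Nat.mul_le_mul_right _ (P.one_lt_sitesPerDir k)
  generalize hr : (x μ).val % P.L ^ k = r at hmod
  have h1 : (r : ℤ) + 1 ≤ ((P.L ^ k : ℕ) : ℤ) := by exact_mod_cast hmod
  have h2 : ((P.L ^ k : ℕ) : ℤ) * 2 ≤ (P.sitesPerDir 0 : ℤ) := by exact_mod_cast (show P.L ^ k * 2 ≤ P.sitesPerDir 0 by omega)
  linarith

/-- `|x − corner|₁ ≤ d·(L^k − 1)` on `B^k(Y)`. [cite: Balaban1984PropagatorsI, (1.7) p.18] -/
theorem l1_rel_corner_le (hk : k ≤ P.m + P.K) {Y : Site P k} {x : Site P 0} (hx : iterBlockOf k x = Y) (h0 : 0 < P.L ^ k) :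
    l1 (rel (Site.fibreSite 0 k Y fun _ => (⟨0, h0⟩ : Fin (P.L ^ k))) x) ≤ P.d * (P.L ^ k - 1) := by
  unfold l1
  calc ∑ ν, (rel (Site.fibreSite 0 k Y fun _ => (⟨0, h0⟩ : Fin (P.L ^ k))) x ν).natAbs ≤ ∑ _ν : Fin P.d, (P.L ^ k - 1) :=
        Finset.sum_le_sum fun ν _ => by
          rw [rel_corner_apply hk hx h0 ν, Int.natAbs_natCast]
          have := Nat.mod_lt ((x ν).val) h0
          omega
    _ = P.d * (P.L ^ k - 1) := by simp

/-- **AT THE BLOCK SITES OF RECORD**: `rel (corner y) (fibreSite 0 k y r) = r` coordinatewise (the corner comb to `x_r` has offsets `r`).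
[cite: Balaban1984PropagatorsI, (1.18) p.20] -/
theorem rel_corner_fibreSite (hk : k ≤ P.m + P.K) (y : Site P k) (h0 : 0 < P.L ^ k) (r : Fin P.d → Fin (P.L ^ k)) :
    rel (Site.fibreSite 0 k y fun _ => (⟨0, h0⟩ : Fin (P.L ^ k))) (Site.fibreSite 0 k y r) = fun ν => ((r ν : ℕ) : ℤ) := by
  have h : P.sitesPerDir 0 = P.L ^ k * P.sitesPerDir k := by rw [sitesPerDir_zero_eq_mul_pow hk, mul_comm]
  funext ν
  rw [rel_corner_apply hk (iterBlockOf_fibreSite hk h y r) h0 ν, Site.val_fibreSite h, add_comm, Nat.add_mul_mod_self_right, Nat.mod_eq_of_lt (r ν).isLt]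

end Blocks

section CornerAxial

variable {G : Type*} [GaugeGroup G] {k : ℕ}

/-- ★ **THE BOND BOUND INSIDE A BLOCK IN THE CORNER-BASED AXIAL GAUGE** ([Balaban1985RegularSpaces] Lemma 1, flat background): if every plaquette variable of `U` is
within `a₀ > 0` of `1`, then in the gauge `W = U^{axialT U (corner Y)}` every fine bond `b` with both endpoints in `B^k(Y)` has `dist1(W_b) ≤ 2d(L^k − 1)·a₀`
(✓`dist1_mul_inv_le_of_axial` against the flat field, comb loop of `|b₋ − corner|₁ ≤ d(L^k−1)` plaquettes, no wrap by `noWrap_corner`).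
[cite: Balaban1985RegularSpaces, Lemma 1 (1.25) p.79; Balaban1985Averaging, pp.24-25] -/
theorem dist1_axial_corner_le (hk : k ≤ P.m + P.K) (U : GaugeField P 0 G) {a₀ : ℝ} (ha₀ : 0 < a₀) (hU : PlaqSmall a₀ U) (h0 : 0 < P.L ^ k)
    (Y : Site P k) (b : PBond P 0) (hb : iterBlockOf k b.src = Y) (hb' : iterBlockOf k b.tgt = Y) :
    dist1 (gaugeActT (axialT U (Site.fibreSite 0 k Y fun _ => (⟨0, h0⟩ : Fin (P.L ^ k)))) U b) ≤ 2 * ((P.d : ℝ) * ((P.L : ℝ) ^ k - 1)) * a₀ := by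
  set q := Site.fibreSite 0 k Y (fun _ => (⟨0, h0⟩ : Fin (P.L ^ k))) with hq
  set W := gaugeActT (axialT U q) U with hW
  have hWs : PlaqSmall a₀ W := plaqSmall_gaugeActT _ hU
  have h1s : PlaqSmall a₀ (fun _ : PBond P 0 => (1 : G)) := fun p => by
    simp only [GaugeField.plaqHol, mul_one, inv_one, GaugeGroup.dist1_one]; exact ha₀
  obtain ⟨x, κ⟩ := b
  have hax : axialT W q x = axialT (fun _ : PBond P 0 => (1 : G)) q x := by
    rw [hW, axialT_gaugeActT_axialT]; unfold axialT; rw [B10Eq27TorusAxialLog.holT_one]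
  have hax' : axialT W q (x.shift κ) = axialT (fun _ : PBond P 0 => (1 : G)) q (x.shift κ) := by
    rw [hW, axialT_gaugeActT_axialT]; unfold axialT; rw [B10Eq27TorusAxialLog.holT_one]
  have hwrap := noWrap_corner hk hb h0 κ
  have h := dist1_mul_inv_le_of_axial W (fun _ : PBond P 0 => (1 : G)) ha₀.le ha₀.le hWs h1s q x κ hwrap hax hax'
  simp only [inv_one, mul_one] at h
  refine h.trans ?_
  have hl1 : (l1 (rel q x) : ℝ) ≤ (P.d : ℝ) * ((P.L : ℝ) ^ k - 1) := by
    have h1 := l1_rel_corner_le hk hb h0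
    have hL1 : 1 ≤ P.L ^ k := h0
    have : ((l1 (rel q x) : ℕ) : ℝ) ≤ ((P.d * (P.L ^ k - 1) : ℕ) : ℝ) := by exact_mod_cast h1
    rw [Nat.cast_mul, Nat.cast_sub hL1, Nat.cast_pow, Nat.cast_one] at this
    exact this
  have : (l1 (rel q x) : ℝ) * (a₀ + a₀) ≤ (P.d : ℝ) * ((P.L : ℝ) ^ k - 1) * (a₀ + a₀) := mul_le_mul_of_nonneg_right hl1 (by positivity)
  linarith

end CornerAxial

/-! ## §2 The gauge-indexed references and the row `hclose` -/

section Tower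

variable {𝔸 : Type*} [NormedRing 𝔸] [NormedAlgebra ℂ 𝔸] [CompleteSpace 𝔸]

/-- **COVARIANCE OF THE TOWER, READ ON A STAIRCASE** ([Balaban1985Averaging] (11) iterated, ✓`Prop8Chart.emlIterU_gaugeActT` with the gauge read at the iterated
centres): for every fine gauge transformation `w`, `w(embIter (j+1) y)·Ū⁽ʲ⁾(Γ^σ_{y,i})·w(embIter j x_{y,i})⁻¹ = Ū⁽ʲ⁾[U^{w}](Γ^σ_{y,i})` (the staircase from the centre
`emb y` ends at `x_{y,i} = blockSite y i.1`, ✓`walkEnd_emb_stairWord_eq_blockSite`). [cite: Balaban1985Averaging, (8)-(11) pp.18-19, (97) p.32; Balaban1987RG1, (0.3) p.252] -/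
theorem holT_tower_conj_eq (U : GaugeField P 0 𝔸ˣ) (w : GaugeTransf P 0 𝔸ˣ) (j : ℕ) (y : Site P (j + 1)) (i : Idx P) :
    w (embIter (j + 1) y) * holT (emlIterU j U) (emb y) (stairWord i.2.1 (off i.1)) * (w (embIter j (Site.blockSite y i.1)))⁻¹
      = holT (emlIterU j (gaugeActT w U)) (emb y) (stairWord i.2.1 (off i.1)) := by
  have hcov := emlIterU_gaugeActT (fun l (z : Site P l) => w (embIter l z)) (fun _ _ => rfl) U j
  rw [show gaugeActT w U = gaugeActT (fun z : Site P 0 => w (embIter 0 z)) U from rfl, hcov, holT_gaugeActT,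
    walkEnd_emb_stairWord_eq_blockSite]
  rfl

variable [NormOneClass 𝔸] {k : ℕ}

omit [NormedAlgebra ℂ 𝔸] [CompleteSpace 𝔸] [NormOneClass 𝔸] in
/-- `hC0`: the reference of the base level at the site itself is `1` (group law; `embIter 0 x = x`). [cite: Balaban1984PropagatorsI, (1.18) p.20] -/
theorem ref_zero_self (U : GaugeField P 0 𝔸ˣ) (q : Site P k → Site P 0) (x : Site P 0) :
    (axialT U (q (iterBlockOf k x)) (embIter 0 x))⁻¹ * axialT U (q (iterBlockOf k x)) x = 1 :=
  inv_mul_cancel _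

omit [NormedAlgebra ℂ 𝔸] [CompleteSpace 𝔸] in
/-- the references are `U1`-valued when `U` is (comb holonomies). [cite: Balaban1985Averaging, (19)-(20) p.21] -/
theorem ref_mem_U1 (U : GaugeField P 0 𝔸ˣ) (hU : ∀ b, U b ∈ U1 𝔸) (q : Site P k → Site P 0) (j : ℕ) (z : Site P j) (x : Site P 0) :
    (axialT U (q (iterBlockOf k x)) (embIter j z))⁻¹ * axialT U (q (iterBlockOf k x)) x ∈ U1 𝔸 := by
  unfold axialT
  exact (U1 𝔸).mul_mem ((U1 𝔸).inv_mem (holT_mem_U1 hU _ _)) (holT_mem_U1 hU _ _)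

/-- ★★ **THE ROW `hclose` AT THE GAUGE-INDEXED REFERENCES, EVERY LEVEL `j + 1 ≤ k`, EVERY BASE-POINT MAP `q`.**  Let `U` be `U1`-valued with `U1`-valued `j`-th
average, and suppose (`hax`) that for every top block `Y` the fine bonds with both endpoints in `B^k(Y)` are `s₀`-close to `1` in the axial gauge `axialT U (q Y)`,
with the budget `6400ℓ²Lʲs₀ ≤ 1` of [Balaban1985Averaging] Prop. 4.  Then for `x ∈ B^j(x_{y,i})`, `T = Ū⁽ʲ⁾(Γ^σ_{y,i})`, `w_x = axialT U (q (B^k x))`: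
`‖T·(w_x(embIter j x_{y,i}))⁻¹·w_x(x) − (w_x(embIter (j+1) y))⁻¹·w_x(x)‖ ≤ ℓ·(30ℓ·Lʲ·s₀)` — the defect is `‖Ū⁽ʲ⁾[U^{w_x}](Γ^σ_{y,i}) − 1‖` up to `U1` isometries
(`holT_tower_conj_eq`), the staircase stays in `B(y) ⊂ B^k(B^k x)` (✓`ChartHInv.blockOf_of_mem_walk_stairWord`, `iterBlockOf_eq_of_le`), and every bond it traverses
obeys ✓`Prop8Chart.norm_emlIterU_sub_one_le_of_reads`. [cite: Balaban1985Averaging, Prop. 4 (134)-(135) p.38, (11) p.19, (97) p.32; Balaban1985RegularSpaces, Lemma 1 p.79] -/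
theorem norm_stair_mul_ref_sub_ref_le {j : ℕ} (hjk : j + 1 ≤ k) (hk : k ≤ P.m + P.K) (U : GaugeField P 0 𝔸ˣ) (hU : ∀ b, U b ∈ U1 𝔸)
    (hUj : ∀ b : PBond P j, emlIterU j U b ∈ U1 𝔸) (q : Site P k → Site P 0) {s₀ : ℝ} (hs₀ : 0 ≤ s₀)
    (hbudget : 6400 * (((P.d + 2) * P.L : ℕ) : ℝ) ^ 2 * (P.L : ℝ) ^ j * s₀ ≤ 1)
    (hax : ∀ (Y : Site P k) (b : PBond P 0), iterBlockOf k b.src = Y → iterBlockOf k b.tgt = Y →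
      ‖((gaugeActT (axialT U (q Y)) U b : 𝔸ˣ) : 𝔸) - 1‖ ≤ s₀)
    (y : Site P (j + 1)) (i : Idx P) (x : Site P 0) (hx : x ∈ iterBlock j (Site.blockSite y i.1)) :
    ‖((holT (emlIterU j U) (emb y) (stairWord i.2.1 (off i.1)) : 𝔸ˣ) : 𝔸) *
        (((axialT U (q (iterBlockOf k x)) (embIter j (Site.blockSite y i.1)))⁻¹ * axialT U (q (iterBlockOf k x)) x : 𝔸ˣ) : 𝔸)
      - (((axialT U (q (iterBlockOf k x)) (embIter (j + 1) y))⁻¹ * axialT U (q (iterBlockOf k x)) x : 𝔸ˣ) : 𝔸)‖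
      ≤ (((P.d + 2) * P.L : ℕ) : ℝ) * (30 * (((P.d + 2) * P.L : ℕ) : ℝ) * (P.L : ℝ) ^ j * s₀) := by
  have hj1 : j + 1 ≤ P.m + P.K := hjk.trans hk
  have hjm : j ≤ P.m + P.K := (Nat.le_succ j).trans hj1
  set Y := iterBlockOf k x with hY
  set u : GaugeTransf P 0 𝔸ˣ := axialT U (q Y) with hu
  set W : GaugeField P 0 𝔸ˣ := gaugeActT u U with hW
  set Γ := stairWord i.2.1 (off i.1) with hΓ
  set T : 𝔸ˣ := holT (emlIterU j U) (emb y) Γ with hT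
  set z' : Site P 0 := embIter j (Site.blockSite y i.1) with hz'
  set y' : Site P 0 := embIter (j + 1) y with hy'
  have hu1 : ∀ z, u z ∈ U1 𝔸 := fun z => by rw [hu]; unfold axialT; exact holT_mem_U1 hU _ _
  -- the `j`-th average of the gauged field is the gauged `j`-th average
  have hcovW : emlIterU j W = gaugeActT (fun z : Site P j => u (embIter j z)) (emlIterU j U) := by
    have hcov := emlIterU_gaugeActT (fun l (z : Site P l) => u (embIter l z)) (fun _ _ => rfl) U j
    rw [hW, show gaugeActT u U = gaugeActT (fun z : Site P 0 => u (embIter 0 z)) U from rfl, hcov]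
  have hWj : ∀ b : PBond P j, emlIterU j W b ∈ U1 𝔸 := fun b => by
    rw [hcovW, gaugeActT_apply]
    exact (U1 𝔸).mul_mem ((U1 𝔸).mul_mem (hu1 _) (hUj b)) ((U1 𝔸).inv_mem (hu1 _))
  -- Step A: factor out `w_x(x)` and the inverse frame at `y′`
  have hA : ((T : 𝔸ˣ) : 𝔸) * ((((u z')⁻¹ * u x : 𝔸ˣ)) : 𝔸) - ((((u y')⁻¹ * u x : 𝔸ˣ)) : 𝔸)
      = (((u y')⁻¹ : 𝔸ˣ) : 𝔸) * (((u y' : 𝔸ˣ) : 𝔸) * (T : 𝔸) * (((u z')⁻¹ : 𝔸ˣ) : 𝔸) - 1) * ((u x : 𝔸ˣ) : 𝔸) := by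
    simp only [Units.val_mul, mul_sub, sub_mul, mul_one, ← mul_assoc, Units.inv_mul, one_mul]
  have hconj : ((u y' : 𝔸ˣ) : 𝔸) * (T : 𝔸) * (((u z')⁻¹ : 𝔸ˣ) : 𝔸) = ((holT (emlIterU j W) (emb y) Γ : 𝔸ˣ) : 𝔸) := by
    rw [← Units.val_mul, ← Units.val_mul, hy', hT, hz', hΓ, hW, holT_tower_conj_eq U u j y i]
  -- Step B: the gauged tower holonomy along the staircase is near `1`
  set S : Set (Site P j) := {v | ∀ x' : Site P 0, iterBlockOf j x' = v → iterBlockOf k x' = Y} with hS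
  have hx1 : iterBlockOf (j + 1) x = y := by
    rw [iterBlockOf_succ, (mem_iterBlock j _ x).1 hx, Site.blockOf_blockSite hj1]
  have hmemS : ∀ st ∈ walk (emb y) Γ, st.bond.src ∈ S ∧ st.bond.tgt ∈ S := by
    intro st hst
    have hb := blockOf_of_mem_walk_stairWord hj1 y i.2.1 i.1 hst
    constructor
    · intro x' hx'
      have h1 : iterBlockOf (j + 1) x' = iterBlockOf (j + 1) x := by rw [iterBlockOf_succ, hx', hb.1, hx1]
      exact iterBlockOf_eq_of_le hjk h1
    · intro x' hx'
      have h1 : iterBlockOf (j + 1) x' = iterBlockOf (j + 1) x := by rw [iterBlockOf_succ, hx', hb.2, hx1]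
      exact iterBlockOf_eq_of_le hjk h1
  have hreads : ∀ b : PBond P 0, iterBlockOf j b.src ∈ S → iterBlockOf j b.tgt ∈ S → ‖((W b : 𝔸ˣ) : 𝔸) - 1‖ ≤ s₀ :=
    fun b hbs hbt => hax Y b (hbs b.src rfl) (hbt b.tgt rfl)
  have hstep : ∀ st ∈ walk (emb y) Γ, ‖((emlIterU j W st.bond : 𝔸ˣ) : 𝔸) - 1‖ ≤ 30 * (((P.d + 2) * P.L : ℕ) : ℝ) * (P.L : ℝ) ^ j * s₀ :=
    fun st hst => norm_emlIterU_sub_one_le_of_reads hjm S W hs₀ hbudget hreads st.bond (hmemS st hst).1 (hmemS st hst).2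
  have hc0 : 0 ≤ 30 * (((P.d + 2) * P.L : ℕ) : ℝ) * (P.L : ℝ) ^ j * s₀ := by positivity
  have hhol := norm_holT_sub_one_le_of_walk (emlIterU j W) hWj hc0 Γ (emb y) hstep
  have hlen : (Γ.length : ℝ) ≤ (((P.d + 2) * P.L : ℕ) : ℝ) := by
    have h := length_walk_stairWord_le (emb y) i.2.1 i.1
    rw [length_walk] at h
    exact_mod_cast h
  -- assemble
  rw [hA]
  calc ‖(((u y')⁻¹ : 𝔸ˣ) : 𝔸) * (((u y' : 𝔸ˣ) : 𝔸) * (T : 𝔸) * (((u z')⁻¹ : 𝔸ˣ) : 𝔸) - 1) * ((u x : 𝔸ˣ) : 𝔸)‖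
      ≤ ‖(((u y')⁻¹ : 𝔸ˣ) : 𝔸)‖ * ‖((u y' : 𝔸ˣ) : 𝔸) * (T : 𝔸) * (((u z')⁻¹ : 𝔸ˣ) : 𝔸) - 1‖ * ‖((u x : 𝔸ˣ) : 𝔸)‖ :=
        (norm_mul_le _ _).trans (mul_le_mul_of_nonneg_right (norm_mul_le _ _) (norm_nonneg _))
    _ ≤ 1 * ‖((u y' : 𝔸ˣ) : 𝔸) * (T : 𝔸) * (((u z')⁻¹ : 𝔸ˣ) : 𝔸) - 1‖ * 1 := by
        gcongr
        · exact (mem_U1.1 (hu1 y')).2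
        · exact (mem_U1.1 (hu1 x)).1
    _ = ‖((holT (emlIterU j W) (emb y) Γ : 𝔸ˣ) : 𝔸) - 1‖ := by rw [one_mul, mul_one, hconj]
    _ ≤ Γ.length * (30 * (((P.d + 2) * P.L : ℕ) : ℝ) * (P.L : ℝ) ^ j * s₀) := hhol
    _ ≤ (((P.d + 2) * P.L : ℕ) : ℝ) * (30 * (((P.d + 2) * P.L : ℕ) : ℝ) * (P.L : ℝ) ^ j * s₀) := mul_le_mul_of_nonneg_right hlen hc0

end Tower

/-! ## §3 The top level at the corner base: px20's row `hC` as an identity -/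

section Top

variable {G : Type*} [Group G] {k : ℕ}

/-- ★ **`hC` EXACTLY**: at the top level `k` and the CORNER base `q Y = fibreSite 0 k Y 0` the reference at the block site `x_r = fibreSite 0 k y r` reads
`C_{k,y,x_r} = g_y · U(Γ_{corner(y), r})` with `g_y = (axialT U (corner y) (embIter k y))⁻¹`: `B^k(x_r) = y` (✓`Prop7CombGauge.iterBlockOf_fibreSite`) and the corner comb
to `x_r` has offsets `r` (`rel_corner_fibreSite`). [cite: Balaban1984PropagatorsI, (1.7) p.18, (1.18) p.20; Balaban1985Averaging, pp.24-25] -/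
theorem ref_top_fibreSite_eq (hk : k ≤ P.m + P.K) (U : GaugeField P 0 G) (h0 : 0 < P.L ^ k) (y : Site P k) (r : Fin P.d → Fin (P.L ^ k)) :
    (axialT U (Site.fibreSite 0 k (iterBlockOf k (Site.fibreSite 0 k y r)) fun _ => (⟨0, h0⟩ : Fin (P.L ^ k))) (embIter k y))⁻¹ *
        axialT U (Site.fibreSite 0 k (iterBlockOf k (Site.fibreSite 0 k y r)) fun _ => (⟨0, h0⟩ : Fin (P.L ^ k))) (Site.fibreSite 0 k y r)
      = (axialT U (Site.fibreSite 0 k y fun _ => (⟨0, h0⟩ : Fin (P.L ^ k))) (embIter k y))⁻¹ *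
          holT U (Site.fibreSite 0 k y fun _ => (⟨0, h0⟩ : Fin (P.L ^ k))) (treeWord fun ν => ((r ν : ℕ) : ℤ)) := by
  have h : P.sitesPerDir 0 = P.L ^ k * P.sitesPerDir k := by rw [sitesPerDir_zero_eq_mul_pow hk, mul_comm]
  rw [iterBlockOf_fibreSite hk h y r]
  congr 1
  unfold axialT
  rw [rel_corner_fibreSite hk y h0 r]

end Top

end Summit.QuantumFields.YangMills.Theorems.Prop7NestedMeanTowerCloseness

end
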